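import Literature.RepresentationTheory.Kovacevic2021.SU21PrincipalSeriesSubmoduleLattice
import Literature.Algebra.Lie.LieSubmoduleJordanHolder
import HarnessLib

/-!
# Every `V(c, 2t)` has finite length: composition series of Kovačević's principal-series data exist

Sequel to `…Kovacevic2021.SU21PrincipalSeriesSubmoduleLattice` (the lattice of Lie submodules of `V(c,2t)` is
finite, `principalSeries_lieSubmodule_finite`) and `Literature.Algebra.Lie.LieSubmoduleJordanHolder` (Lie submodules
form a Jordan–Hölder lattice; composition series exist under both chain conditions).  For EVERY `(c, t)`:

* `principalSeries_exists_compositionSeries`: `V(c,2t)` has a composition series of Lie submodules from `0` to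
  `V(c,2t)` (successive subquotients irreducible, `Literature.Algebra.Lie.covBy_iff_isIrreducible`), i.e. `V(c,2t)` has
  finite length [Kovacevic2021, §3 Thm 3 and Remark 6: "it is not complicated to analyze all cases"]; any two are
  equivalent (`principalSeries_compositionSeries_equivalent`, Mathlib's `CompositionSeries.jordan_holder`)
  [BourbakiAlgebraI1989, Chap. I §4 no. 7 Thm. 6].

The explicit series at the cohomological points `(0,0)`, `(−3/2, ±3)` are in `SU21PrincipalSeriesJordanHolder`.
Theorems only; no definitions, no named facts.

## References

* D. Kovačević, *Unitary `(𝔤,K)` modules of `SU(2,1)`*, Acta Math. Spalatensia 1 (2021) 105–125, §3 Thm 3,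
  Remark 6. [Kovacevic2021]
* N. Bourbaki, *Algebra I*, Chap. I §4 no. 7 Thm. 6 and the Remark following it. [BourbakiAlgebraI1989]
-/

namespace Literature.RepresentationTheory.Kovacevic2021

-- Mathlib idiom (Mathlib/Algebra/Lie/OfAssociative.lean): commutator brackets on associative algebras; needed for
-- the `𝔤𝔩(3,ℂ)`-module structure on `𝒟.V`, as in every file of this directory.
attribute [local instance 100] LieRing.ofAssociativeRing

namespace SU21Datum

open PrincipalSeries Literature.Algebra.Lie

/-- **`V(c,2t)` has a composition series of Lie submodules from `0` to `V(c,2t)`** (its submodule lattice is finite,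
so both chain conditions hold); in particular `V(c,2t)` has finite length.
[cite: Kovacevic2021, §3 Thm 3 and Remark 6] [cite: BourbakiAlgebraI1989, Chap. I §4 no. 7, Remark after Thm. 6] -/
theorem principalSeries_exists_compositionSeries (c : ℂ) (t : ℤ) :
    ∃ s : CompositionSeries (LieSubmodule ℂ (Matrix (Fin 3) (Fin 3) ℂ) (principalSeries c t).V),
      s.head = ⊥ ∧ s.last = ⊤ := by
  haveI := principalSeries_lieSubmodule_finite c t
  exact exists_compositionSeries_of_wellFounded

/-- **Jordan–Hölder for `V(c,2t)`**: any two composition series of `V(c,2t)` from `0` to `V(c,2t)` are equivalent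
(same length, isomorphic subquotients up to a permutation). [cite: BourbakiAlgebraI1989, Chap. I §4 no. 7 Thm. 6]
[cite: Kovacevic2021, §3 Remark 6] -/
theorem principalSeries_compositionSeries_equivalent {c : ℂ} {t : ℤ}
    (s₁ s₂ : CompositionSeries (LieSubmodule ℂ (Matrix (Fin 3) (Fin 3) ℂ) (principalSeries c t).V))
    (h₁ : s₁.head = ⊥) (h₁' : s₁.last = ⊤) (h₂ : s₂.head = ⊥) (h₂' : s₂.last = ⊤) :
    CompositionSeries.Equivalent s₁ s₂ ∧ s₁.length = s₂.length := by
  have h := CompositionSeries.jordan_holder s₁ s₂ (h₁.trans h₂.symm) (h₁'.trans h₂'.symm)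
  exact ⟨h, h.length_eq⟩

end SU21Datum

end Literature.RepresentationTheory.Kovacevic2021
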